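import Literature.MathematicalPhysics.QuantumManyBody.GroundState
import Literature.MathematicalPhysics.QuantumManyBody.SwapPurity
import Literature.MathematicalPhysics.QuantumManyBody.CondensateOccupationStability

/-!
# Route `BECThomsonPrinciple`, crux `PeriodicToDirichlet` (stmt-AtomisticToContinuum-9483),
# line `Sketch` (torus-in-the-box-doob): registered stub `stub_condensedFromGroundState` (G2)

From the ground state to trial states at every slack: if the nondegenerate Dirichlet ground state
`Ψ₀ = groundState v (m+1) L` occupies a normalised measurable mode `φ` with `occ_φ(Ψ₀) ≥ c(m+1)`,
then for every `ε > 0` some trial state within `ε` of `E₀` has `occ_φ ≥ (c/4)(m+1)` (the ground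
state is an `L²`-limit of trial states whose energies have `liminf ≤ E₀`; `√occ_φ` is
`√N‖φ‖₂`-Lipschitz on `L²`). [folklore]

The pattern is the tree file
`Summits/AtomisticToContinuum/BoseEinsteinCondensation/Theorems/BECThomsonPrinciplePeriodicToDirichletNearMinimiserTransfer.lean`
(seminorm property of `√occ_φ`, bound `occ_φ ≤ N‖φ‖₂²‖·‖₂²`, bookkeeping `√(cN) ≤ b + √(cN)/4`);
the only change is that the ground state `Ψ₀` is merely measurable and square integrable, so the
linearity of `a_φ(Ψ)(Y) = ∫ conj φ(x) Ψ(x::Y) dx` in `Ψ` is only available for a.e. `Y` (the slices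
`Ψ₀(·::Y)` are in `L²(ℝ³)` for a.e. `Y` by Tonelli, and pair integrably with `φ ∈ L²` by
Cauchy–Schwarz); the pointwise triangle inequality is then integrated with `lintegral_mono_ae`.
-/

noncomputable section

open MeasureTheory Filter
open scoped ENNReal NNReal ComplexConjugate

namespace Summit.AtomisticToContinuum.BoseEinsteinCondensation.TorusInTheBox

open Literature.MathematicalPhysics.QuantumManyBody.BoseGas

/-! ### `√occ_φ` is a seminorm bounded by `√N ‖φ‖₂ ‖·‖₂` (a.e. form) -/

-- adapted from BECThomsonPrinciplePeriodicToDirichletNearMinimiserTransfer.lean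
-- (`measurable_integral_conj_mul_vecCons`, private there)
/-- `Y ↦ a_φ(Ψ)(Y) = ∫ conj φ(x) Ψ(x::Y) dx` is measurable for measurable `φ`, `Ψ`. [folklore] -/
private theorem measurable_integral_conj_mul_vecCons' {φ : Space → ℂ} (hφ : Measurable φ) {n : ℕ}
    {Ψ : Config (n + 1) → ℂ} (hΨ : Measurable Ψ) :
    Measurable fun Y : Config n => ∫ x, conj (φ x) * Ψ (Matrix.vecCons x Y) := by
  have h : StronglyMeasurable (Function.uncurry fun (Y : Config n) (x : Space) =>
      conj (φ x) * Ψ (Matrix.vecCons x Y)) := by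
    refine Measurable.stronglyMeasurable ?_
    exact (Complex.continuous_conj.measurable.comp (hφ.comp measurable_snd)).mul
      (hΨ.comp (continuous_snd.matrixVecCons continuous_fst).measurable)
  exact (h.integral_prod_right' (ν := (volume : Measure Space))).measurable

/-- **Slices of an `L²` function pair integrably with an `L²` mode, a.e.**: for measurable
`φ ∈ L²(ℝ³)` and measurable `Ψ ∈ L²((ℝ³)^{n+1})`, the function `x ↦ conj φ(x) Ψ(x::Y)` is
integrable for a.e. `Y ∈ (ℝ³)ⁿ` (Tonelli: `∫ dY ∫ dx |Ψ(x::Y)|² = ‖Ψ‖₂² < ∞`, so a.e. slice is in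
`L²`; then Cauchy–Schwarz). [folklore] -/
private theorem ae_integrable_conj_mul_vecCons {φ : Space → ℂ} (hφ : Measurable φ)
    (hφ2 : ∫⁻ x, (‖φ x‖₊ : ℝ≥0∞) ^ 2 ≠ ⊤) {n : ℕ} {Ψ : Config (n + 1) → ℂ} (hΨ : Measurable Ψ)
    (hΨ2 : ∫⁻ X, (‖Ψ X‖₊ : ℝ≥0∞) ^ 2 ≠ ⊤) :
    ∀ᵐ Y : Config n, Integrable (fun x => conj (φ x) * Ψ (Matrix.vecCons x Y)) := by
  have hae : ∀ᵐ Y : Config n, ∫⁻ x : Space, (‖Ψ (Matrix.vecCons x Y)‖₊ : ℝ≥0∞) ^ 2 < ⊤ :=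
    ae_lt_top (measurable_lintegral_sq_nnnorm_vecCons hΨ)
      (by rwa [lintegral_lintegral_sq_nnnorm_vecCons hΨ])
  filter_upwards [hae] with Y hY
  have hslice : Measurable fun x : Space => Ψ (Matrix.vecCons x Y) :=
    measurable_comp_vecCons_left hΨ Y
  refine ⟨((Complex.continuous_conj.measurable.comp hφ).mul hslice).aestronglyMeasurable, ?_⟩
  show ∫⁻ x, ‖conj (φ x) * Ψ (Matrix.vecCons x Y)‖ₑ < ⊤
  have heq : ∫⁻ x, ‖conj (φ x) * Ψ (Matrix.vecCons x Y)‖ₑ =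
      ∫⁻ x, (‖φ x‖₊ : ℝ≥0∞) * ‖Ψ (Matrix.vecCons x Y)‖₊ := by
    refine lintegral_congr fun x => ?_
    rw [enorm_eq_nnnorm, nnnorm_mul, ENNReal.coe_mul, RCLike.nnnorm_conj]
  have h2 : (∫⁻ x, (‖φ x‖₊ : ℝ≥0∞) * ‖Ψ (Matrix.vecCons x Y)‖₊) ^ 2 < ⊤ :=
    lt_of_le_of_lt (lintegral_mul_sq_le volume hφ.nnnorm.coe_nnreal_ennreal.aemeasurable
      hslice.nnnorm.coe_nnreal_ennreal.aemeasurable) (ENNReal.mul_lt_top hφ2.lt_top hY)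
  rw [heq]
  exact (ENNReal.pow_lt_top_iff.1 h2).resolve_right two_ne_zero

-- adapted from BECThomsonPrinciplePeriodicToDirichletNearMinimiserTransfer.lean
-- (`occupation_rpow_half_le_add`, there for everywhere-integrable slices)
/-- **`√occ_φ` is a seminorm** (a.e. form): `occ_φ(Ψ₁)^{1/2} ≤ occ_φ(Ψ₂)^{1/2} + occ_φ(Ψ₁ - Ψ₂)^{1/2}`
for measurable `N = n+1`-body functions whose slices pair integrably with `φ` for a.e. `Y`
(linearity of `a_φ(Ψ)(Y) = ∫ conj φ(x) Ψ(x::Y) dx` in `Ψ` for a.e. `Y`, the pointwise triangle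
inequality a.e., and Minkowski in `L²((ℝ³)ⁿ)`). [folklore] -/
private theorem occupation_rpow_half_le_add_ae {φ : Space → ℂ} (hφ : Measurable φ) {n : ℕ}
    {Ψ₁ Ψ₂ : Config (n + 1) → ℂ} (hΨ₁ : Measurable Ψ₁) (hΨ₂ : Measurable Ψ₂)
    (h₁ : ∀ᵐ Y : Config n, Integrable (fun x => conj (φ x) * Ψ₁ (Matrix.vecCons x Y)))
    (h₂ : ∀ᵐ Y : Config n, Integrable (fun x => conj (φ x) * Ψ₂ (Matrix.vecCons x Y))) :
    occupation (n + 1) φ Ψ₁ ^ (1 / 2 : ℝ) ≤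
      occupation (n + 1) φ Ψ₂ ^ (1 / 2 : ℝ) +
        occupation (n + 1) φ (fun X => Ψ₁ X - Ψ₂ X) ^ (1 / 2 : ℝ) := by
  -- pointwise triangle inequality, for a.e. `Y`
  have hpt : ∀ᵐ Y : Config n, (‖∫ x, conj (φ x) * Ψ₁ (Matrix.vecCons x Y)‖₊ : ℝ≥0∞) ^ 2 ≤
      ((‖∫ x, conj (φ x) * Ψ₂ (Matrix.vecCons x Y)‖₊ : ℝ≥0∞) +
        (‖∫ x, conj (φ x) * (Ψ₁ (Matrix.vecCons x Y) - Ψ₂ (Matrix.vecCons x Y))‖₊ : ℝ≥0∞)) ^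
          2 := by
    filter_upwards [h₁, h₂] with Y hY₁ hY₂
    have hY₃ : Integrable
        (fun x => conj (φ x) * (Ψ₁ (Matrix.vecCons x Y) - Ψ₂ (Matrix.vecCons x Y))) :=
      (hY₁.sub hY₂).congr (ae_of_all _ fun x => by simp only [Pi.sub_apply, mul_sub])
    -- linearity of `a_φ`
    have hlin : ∫ x, conj (φ x) * Ψ₁ (Matrix.vecCons x Y) =
        (∫ x, conj (φ x) * Ψ₂ (Matrix.vecCons x Y)) +
          ∫ x, conj (φ x) * (Ψ₁ (Matrix.vecCons x Y) - Ψ₂ (Matrix.vecCons x Y)) := by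
      rw [← integral_add hY₂ hY₃]
      congr 1
      funext x
      ring
    have hle : (‖∫ x, conj (φ x) * Ψ₁ (Matrix.vecCons x Y)‖₊ : ℝ≥0∞) ≤
        (‖∫ x, conj (φ x) * Ψ₂ (Matrix.vecCons x Y)‖₊ : ℝ≥0∞) +
          (‖∫ x, conj (φ x) * (Ψ₁ (Matrix.vecCons x Y) - Ψ₂ (Matrix.vecCons x Y))‖₊ : ℝ≥0∞) := by
      rw [hlin]
      exact_mod_cast nnnorm_add_le _ _
    gcongr
  -- Minkowski in `L²((ℝ³)ⁿ)`
  have hm₂ : AEMeasurable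
      (fun Y : Config n => (‖∫ x, conj (φ x) * Ψ₂ (Matrix.vecCons x Y)‖₊ : ℝ≥0∞)) volume :=
    (measurable_integral_conj_mul_vecCons' hφ hΨ₂).nnnorm.coe_nnreal_ennreal.aemeasurable
  have hm₃ : AEMeasurable (fun Y : Config n =>
      (‖∫ x, conj (φ x) * (Ψ₁ (Matrix.vecCons x Y) - Ψ₂ (Matrix.vecCons x Y))‖₊ : ℝ≥0∞))
      volume :=
    (measurable_integral_conj_mul_vecCons' hφ (hΨ₁.sub hΨ₂)).nnnorm.coe_nnreal_ennreal.aemeasurable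
  have hmink := ENNReal.lintegral_Lp_add_le hm₂ hm₃ (by norm_num : (1 : ℝ) ≤ 2)
  simp only [Pi.add_apply, ENNReal.rpow_two] at hmink
  have hI : (∫⁻ Y : Config n,
      (‖∫ x, conj (φ x) * Ψ₁ (Matrix.vecCons x Y)‖₊ : ℝ≥0∞) ^ 2) ^ (1 / 2 : ℝ) ≤
      (∫⁻ Y : Config n,
        (‖∫ x, conj (φ x) * Ψ₂ (Matrix.vecCons x Y)‖₊ : ℝ≥0∞) ^ 2) ^ (1 / 2 : ℝ) +
      (∫⁻ Y : Config n,
        (‖∫ x, conj (φ x) * (Ψ₁ (Matrix.vecCons x Y) - Ψ₂ (Matrix.vecCons x Y))‖₊ : ℝ≥0∞) ^ 2) ^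
          (1 / 2 : ℝ) :=
    le_trans (ENNReal.rpow_le_rpow (lintegral_mono_ae hpt) (by norm_num)) hmink
  simp only [occupation]
  rw [ENNReal.mul_rpow_of_nonneg _ _ (by norm_num : (0 : ℝ) ≤ 1 / 2),
    ENNReal.mul_rpow_of_nonneg _ _ (by norm_num : (0 : ℝ) ≤ 1 / 2),
    ENNReal.mul_rpow_of_nonneg _ _ (by norm_num : (0 : ℝ) ≤ 1 / 2), ← mul_add]
  exact mul_le_mul_right hI _

-- adapted from BECThomsonPrinciplePeriodicToDirichletNearMinimiserTransfer.lean
-- (`occupation_le_mul_lintegral`, private there)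
/-- **`a_φ` is bounded by `√N ‖φ‖₂`**: `occ_φ(Ψ) ≤ N ‖φ‖₂² ‖Ψ‖₂²` for measurable `φ`, `Ψ`
(Cauchy–Schwarz in the contracted particle, then Tonelli `∫ dŶ ∫ dx |Ψ(x::Ŷ)|² = ‖Ψ‖₂²`).
[folklore] -/
private theorem occupation_le_mul_lintegral' {φ : Space → ℂ} (hφ : Measurable φ) :
    ∀ {N : ℕ} {Ψ : Config N → ℂ}, Measurable Ψ →
      occupation N φ Ψ ≤
        (N : ℝ≥0∞) * (∫⁻ x, (‖φ x‖₊ : ℝ≥0∞) ^ 2) * ∫⁻ X, (‖Ψ X‖₊ : ℝ≥0∞) ^ 2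
  | 0, _, _ => by simp [occupation]
  | n + 1, Ψ, hΨ => by
    have hpt : ∀ Y : Config n, (‖∫ x, conj (φ x) * Ψ (Matrix.vecCons x Y)‖₊ : ℝ≥0∞) ^ 2 ≤
        (∫⁻ x, (‖Ψ (Matrix.vecCons x Y)‖₊ : ℝ≥0∞) ^ 2) * ∫⁻ x, (‖φ x‖₊ : ℝ≥0∞) ^ 2 := by
      intro Y
      have h := sq_nnnorm_integral_mul_conj_le (ν := (volume : Measure Space))
        (measurable_comp_vecCons_left hΨ Y).aemeasurable hφ.aemeasurable
      have hfun : (fun x => conj (φ x) * Ψ (Matrix.vecCons x Y)) =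
          fun x => Ψ (Matrix.vecCons x Y) * conj (φ x) := funext fun x => mul_comm _ _
      rwa [hfun]
    calc occupation (n + 1) φ Ψ
        = (n + 1 : ℝ≥0∞) *
            ∫⁻ Y : Config n, (‖∫ x, conj (φ x) * Ψ (Matrix.vecCons x Y)‖₊ : ℝ≥0∞) ^ 2 := rfl
      _ ≤ (n + 1 : ℝ≥0∞) * ∫⁻ Y : Config n,
            (∫⁻ x, (‖Ψ (Matrix.vecCons x Y)‖₊ : ℝ≥0∞) ^ 2) * ∫⁻ x, (‖φ x‖₊ : ℝ≥0∞) ^ 2 := by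
          gcongr with Y
          exact hpt Y
      _ = (n + 1 : ℝ≥0∞) *
            ((∫⁻ X, (‖Ψ X‖₊ : ℝ≥0∞) ^ 2) * ∫⁻ x, (‖φ x‖₊ : ℝ≥0∞) ^ 2) := by
          rw [lintegral_mul_const _ (measurable_lintegral_sq_nnnorm_vecCons hΨ),
            lintegral_lintegral_sq_nnnorm_vecCons hΨ]
      _ = ((n + 1 : ℕ) : ℝ≥0∞) * (∫⁻ x, (‖φ x‖₊ : ℝ≥0∞) ^ 2) * ∫⁻ X, (‖Ψ X‖₊ : ℝ≥0∞) ^ 2 := by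
          push_cast
          ring

/-! ### The bookkeeping `√(cN) ≤ √occ + √(cN)/4 ⇒ (c/4)N ≤ occ` -/

-- adapted from BECThomsonPrinciplePeriodicToDirichletNearMinimiserTransfer.lean
-- (`ofReal_quarter_mul_le_sq`, private there)
/-- If `√(cN) ≤ b + √(cN)/4` in `ℝ≥0∞` then `(c/4) N ≤ b²` (indeed `(9/16) c N ≤ b²`). [folklore] -/
private theorem ofReal_quarter_mul_le_sq' {c : ℝ} (hc : 0 ≤ c) (N : ℕ) {b : ℝ≥0∞}
    (h : ENNReal.ofReal (Real.sqrt (c * N)) ≤ b + ENNReal.ofReal (Real.sqrt (c * N) / 4)) :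
    ENNReal.ofReal (c / 4 * N) ≤ b ^ 2 := by
  have hcN : 0 ≤ c * N := by positivity
  have h1 : ENNReal.ofReal (3 / 4 * Real.sqrt (c * N)) ≤ b := by
    rw [show 3 / 4 * Real.sqrt (c * N) = Real.sqrt (c * N) - Real.sqrt (c * N) / 4 by ring,
      ENNReal.ofReal_sub _ (by positivity)]
    exact tsub_le_iff_right.2 h
  calc ENNReal.ofReal (c / 4 * N) ≤ ENNReal.ofReal ((3 / 4 * Real.sqrt (c * N)) ^ 2) := by
        refine ENNReal.ofReal_le_ofReal ?_
        rw [mul_pow, Real.sq_sqrt hcN]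
        nlinarith
    _ = ENNReal.ofReal (3 / 4 * Real.sqrt (c * N)) ^ 2 := by
        rw [ENNReal.ofReal_pow (by positivity)]
    _ ≤ b ^ 2 := by gcongr

/-! ### The registered stub -/

/-- **Registered stub `stub_condensedFromGroundState`** (G2 of line `Sketch`, crux
stmt-AtomisticToContinuum-9483; the skeleton's `CondensedFromGroundState`). [folklore] -/
theorem stub_condensedFromGroundState :
    ∀ (v : ℝ → ℝ≥0∞) (m : ℕ) (L : ℝ) (φ : Space → ℂ), Measurable φ →
      ∫⁻ x, (‖φ x‖₊ : ℝ≥0∞) ^ 2 ≤ 1 → HasUniqueGroundState v (m + 1) L → ∀ c : ℝ, 0 ≤ c →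
        ENNReal.ofReal (c * (m + 1 : ℕ)) ≤
            occupation (m + 1) φ (fun X => (groundState v (m + 1) L X : ℂ)) →
          ∀ ε : ℝ≥0∞, 0 < ε → ∃ Φ : TrialState (m + 1) L,
            energy v Φ ≤ groundStateEnergy v (m + 1) L + ε ∧
              ENNReal.ofReal (c / 4 * (m + 1 : ℕ)) ≤ occupation (m + 1) φ Φ.ψ := by
  intro v m L φ hφ hφ1 hU c hc hocc ε hε
  -- the ground state `Ψ₀`, its energy `E₀ < ⊤`, and an approximating sequence of trial states
  set Ψ₀ : Config (m + 1) → ℂ := fun X => (groundState v (m + 1) L X : ℂ) with hΨ₀def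
  have hgs : IsGroundState v L Ψ₀ := hU.isGroundState_groundState
  have hE : groundStateEnergy v (m + 1) L ≠ ⊤ := hgs.groundStateEnergy_ne_top
  have hlt : closedEnergy v L Ψ₀ < groundStateEnergy v (m + 1) L + ε := by
    rw [hgs.closedEnergy_eq]
    exact ENNReal.lt_add_right hE hε.ne'
  obtain ⟨Φ, hΦ⟩ := iInf_lt_iff.1 hlt
  obtain ⟨hΦΨ, hlim⟩ := iInf_lt_iff.1 hΦ
  -- frequently the energy is below `E₀ + ε`
  have hfreq : ∃ᶠ n in atTop, energy v (Φ n) < groundStateEnergy v (m + 1) L + ε :=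
    frequently_lt_of_liminf_lt (h := hlim)
  rcases hc.eq_or_lt with rfl | hc0
  · -- `c = 0`: the occupation bound is void
    obtain ⟨n, hn⟩ := hfreq.exists
    exact ⟨Φ n, hn.le, by simp⟩
  -- `c > 0`: eventually `‖Φₙ - Ψ₀‖₂² ≤ c/16`
  have hev : ∀ᶠ n in atTop,
      ∫⁻ X, (‖(Φ n).ψ X - Ψ₀ X‖₊ : ℝ≥0∞) ^ 2 ≤ ENNReal.ofReal (c / 16) :=
    ENNReal.tendsto_nhds_zero.1 hΦΨ _ (ENNReal.ofReal_pos.2 (by positivity))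
  obtain ⟨n, hnE, hnd⟩ := (hfreq.and_eventually hev).exists
  refine ⟨Φ n, hnE.le, ?_⟩
  -- the data of `Φₙ` and `Ψ₀`
  have hΦm : Measurable (Φ n).ψ := (Φ n).contDiff.continuous.measurable
  have hΨ₀m : Measurable Ψ₀ := hgs.measurable
  have hΦ2 : ∫⁻ X, (‖(Φ n).ψ X‖₊ : ℝ≥0∞) ^ 2 ≠ ⊤ := by
    rw [(Φ n).norm_eq]
    exact ENNReal.one_ne_top
  have hΨ₀2 : ∫⁻ X, (‖Ψ₀ X‖₊ : ℝ≥0∞) ^ 2 ≠ ⊤ := by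
    rw [hgs.norm_eq]
    exact ENNReal.one_ne_top
  have hφ2 : ∫⁻ x, (‖φ x‖₊ : ℝ≥0∞) ^ 2 ≠ ⊤ := ne_top_of_le_ne_top ENNReal.one_ne_top hφ1
  -- `√occ(Ψ₀) ≤ √occ(Φₙ) + √occ(Ψ₀ - Φₙ)`
  have hsemi := occupation_rpow_half_le_add_ae hφ hΨ₀m hΦm
    (ae_integrable_conj_mul_vecCons hφ hφ2 hΨ₀m hΨ₀2)
    (ae_integrable_conj_mul_vecCons hφ hφ2 hΦm hΦ2)
  -- `occ(Ψ₀ - Φₙ) ≤ N ‖φ‖₂² ‖Ψ₀ - Φₙ‖₂² ≤ N c/16`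
  have hsymm : ∫⁻ X, (‖Ψ₀ X - (Φ n).ψ X‖₊ : ℝ≥0∞) ^ 2 =
      ∫⁻ X, (‖(Φ n).ψ X - Ψ₀ X‖₊ : ℝ≥0∞) ^ 2 := by
    refine lintegral_congr fun X => ?_
    rw [← enorm_eq_nnnorm, enorm_sub_rev, enorm_eq_nnnorm]
  have hbd : occupation (m + 1) φ (fun X => Ψ₀ X - (Φ n).ψ X) ≤
      ((m + 1 : ℕ) : ℝ≥0∞) * ENNReal.ofReal (c / 16) :=
    calc occupation (m + 1) φ (fun X => Ψ₀ X - (Φ n).ψ X)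
        ≤ ((m + 1 : ℕ) : ℝ≥0∞) * (∫⁻ x, (‖φ x‖₊ : ℝ≥0∞) ^ 2) *
            ∫⁻ X, (‖Ψ₀ X - (Φ n).ψ X‖₊ : ℝ≥0∞) ^ 2 :=
          occupation_le_mul_lintegral' hφ (hΨ₀m.sub hΦm)
      _ ≤ ((m + 1 : ℕ) : ℝ≥0∞) * 1 * ENNReal.ofReal (c / 16) := by
          rw [hsymm]
          gcongr
      _ = ((m + 1 : ℕ) : ℝ≥0∞) * ENNReal.ofReal (c / 16) := by rw [mul_one]
  have hkey : occupation (m + 1) φ Ψ₀ ^ (1 / 2 : ℝ) ≤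
      occupation (m + 1) φ (Φ n).ψ ^ (1 / 2 : ℝ) +
        (((m + 1 : ℕ) : ℝ≥0∞) * ENNReal.ofReal (c / 16)) ^ (1 / 2 : ℝ) := by
    refine hsemi.trans ?_
    gcongr
  -- bookkeeping: `√(cN) ≤ √occ(Φₙ) + √(cN)/4`
  have hsq : ∀ x : ℝ≥0∞, (x ^ (1 / 2 : ℝ)) ^ 2 = x := fun x => by
    rw [← ENNReal.rpow_two, ← ENNReal.rpow_mul]
    norm_num
  have hcN : 0 ≤ c * ((m + 1 : ℕ) : ℝ) := by positivity
  have h1 : ENNReal.ofReal (Real.sqrt (c * ((m + 1 : ℕ) : ℝ))) ≤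
      occupation (m + 1) φ Ψ₀ ^ (1 / 2 : ℝ) := by
    rw [← ofReal_rpow_half_eq_sqrt hcN]
    exact ENNReal.rpow_le_rpow hocc (by norm_num)
  have h2 : (((m + 1 : ℕ) : ℝ≥0∞) * ENNReal.ofReal (c / 16)) ^ (1 / 2 : ℝ) =
      ENNReal.ofReal (Real.sqrt (c * ((m + 1 : ℕ) : ℝ)) / 4) := by
    rw [← ENNReal.ofReal_natCast, ← ENNReal.ofReal_mul (Nat.cast_nonneg _),
      ofReal_rpow_half_eq_sqrt (by positivity)]
    congr 1
    rw [show ((m + 1 : ℕ) : ℝ) * (c / 16) = (Real.sqrt (c * ((m + 1 : ℕ) : ℝ)) / 4) ^ 2 by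
      rw [div_pow, Real.sq_sqrt hcN]; ring]
    exact Real.sqrt_sq (by positivity)
  rw [h2] at hkey
  rw [← hsq (occupation (m + 1) φ (Φ n).ψ)]
  exact ofReal_quarter_mul_le_sq' hc (m + 1) (h1.trans hkey)

end Summit.AtomisticToContinuum.BoseEinsteinCondensation.TorusInTheBox

end
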